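import Literature.NumberTheory.GaloisCohomology.LocalInvariantMapConjCompatible
import HarnessLib

/-!
# Families of local invariant maps are place-wise multiples of THE invariant maps; conjugation compatibility
# = constancy of the multipliers along `Aut(K/ℚ)`-orbits; the four- and five-conjunct Poitou–Tate facts differ
# by exactly one RIGIDITY statement

Topic `NumberTheory/GaloisCohomology`; namespace `Literature.NumberTheory.GaloisCohomology`.
PROOF FILE (theorems only: no definition, no named fact, no instance, no notation; D-0026).

The tree carries TWO named facts for Poitou–Tate duality of Selmer structures over a number field `K`:
`poitouTate_selmerStructure_duality K` (`PoitouTateSelmerStructures.lean`: for every `n ≥ 1` SOME family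
`inv : LocalInvariants K n` with `IsPerfect ∧ SumLocalTermEqZero ∧ UnramifiedOrthogonal ∧ SelmerComplement`) and
`poitouTate_selmerStructure_duality_conj K` (`EllipticCurves/PoitouTateSelmerStructuresConj.lean`: the same
PLUS `IsConjCompatible σ` for every `σ ∈ Aut(K/ℚ)`, the input of every sign-by-sign Kolyvagin–Jetchev argument
in the tree).  `_conj → plain` is `poitouTate_selmerStructure_duality_of_conj`; the converse is NOT formal, and
this file says exactly what it amounts to, using only kernel theorems about THE canonical family
`LocalInvariants.canonical K n` (`canonical_isPerfect`: local Tate duality; `localInvariantMap_muConjPlace` /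
`isConjCompatible_canonical`: functoriality of `inv` under the Galois transport of completions):

* `exists_eq_mul_localInvariantMap` — EVERY additive map `H²(K_v, μₙ) →+ ℤ/n`, in particular every finite
  component `inv_v` of every family, is `c ↦ a_v · inv_v^{can}(c)` for a (unique) `a_v ∈ ℤ/n`
  (`H²(K_v, μₙ) ≅ ℤ/n` through THE invariant map); `a_v` is a unit when `inv_v` is bijective
  (`isUnit_of_surjective_of_eq_mul`), e.g. under `IsPerfect`;
* `muConjPlace_two_eq_self` — at a finite place FIXED by `σ`, the transport `σ_*` is the identity on
  `H²(K_v, μₙ)` (THE invariant map is injective and `σ_*`-invariant);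
* `isConjCompatible_iff_forall_mul_eq` — **a family with multipliers `(a_v)_v` is `IsConjCompatible σ` iff
  `a_{σv} = a_v` for every finite `v`**; in particular (`isConjCompatible_of_eq_const_mul`) every CONSTANT multiple
  of the canonical family at the finite places is conjugation compatible, for every `σ`;
* `poitouTate_selmerStructure_duality_conj_of_duality_of_rigid` — **the five-conjunct fact from the
  four-conjunct one plus RIGIDITY**: «every family with `IsPerfect ∧ SumLocalTermEqZero` is, at the finite
  places, a CONSTANT multiple of the canonical family» (displayed hypothesis `hrig`).

HONEST FRAMING.  `hrig` is TRUE for the invariant maps of class field theory (reciprocity `∑_v inv_v = 0` applied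
to global cyclic classes with invariants `(1/n, −1/n)` at two prescribed places forces `a_v = a_w`; existence of
such classes = surjectivity half of `0 → Br K → ⊕_v Br K_v → ℚ/ℤ → 0` on `n`-torsion, Grunwald–Wang + Hasse's
norm theorem), but it is NOT proved here and not in the tree: the tree has the reciprocity law, the Hasse
principle and Hasse's norm theorem for cyclic extensions (`IdeleHerbrand.hasseNorm_of_ideleGalNorm_eq_principal`),
not the Grunwald–Wang existence step.  Nothing here is specific to elliptic curves; no case of Poitou–Tate
duality and no case of BSD is proved.  Written to make the typing gap between the two facts (met by route
SemiOrdinaryEisensteinDescent, item stmt-BirchSwinnertonDyer-25897 vs its rev-19 repair 23092/26257) a kernel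
statement rather than prose.

## References

* J.-P. Serre, *Local class field theory*, Ch. VI of Cassels–Fröhlich (1967), §1.1 (`inv_v : Br(K_v) ≅ ℚ/ℤ`,
  functoriality of `inv`); J. Tate, Ch. VII §9.6, §10 (reciprocity, fundamental exact sequence). [CasselsFrohlichANT1967]
* J. Neukirch, *Class Field Theory — the Bonn Lectures* (2013), Ch. III §6. [Neukirch2013]
* J. S. Milne, *Arithmetic Duality Theorems* (2006), I Cor. 2.3, Thm. 4.10(b). [MilneADT2006]
* E. Artin, J. Tate, *Class Field Theory* (1968/2009), Ch. X (Grunwald–Wang theorem) — cite only.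
-/

noncomputable section

open Function NumberField IsDedekindDomain
open scoped NumberField

namespace Literature.NumberTheory.GaloisCohomology

open Literature.NumberTheory.GaloisRepresentations
open Literature.NumberTheory.GaloisRepresentations.DiscreteGaloisModule (mu)
open Literature.NumberTheory.EllipticCurves

variable {K : Type} [Field K] [NumberField K] (σ : K ≃ₐ[ℚ] K) {N : ℕ} [NeZero N]

namespace LocalInvariants

/-! ### §1 Every component is a multiple of THE invariant map -/

/-- An additive map `g : A →+ ℤ/n` (`n ≥ 1`) factors through a BIJECTIVE additive `f : A →+ ℤ/n` as
`g = a · f` with `a = g (f⁻¹ 1)`. [folklore] -/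
private theorem exists_eq_mul_of_bijective {A : Type*} [AddCommGroup A] (f g : A →+ ZMod N) (hf : Bijective f) :
    ∃ a : ZMod N, ∀ x : A, g x = a * f x := by
  obtain ⟨x₁, hx₁⟩ := hf.2 1
  refine ⟨g x₁, fun x ↦ ?_⟩
  -- `x = (f x).val • x₁ + (x - (f x).val • x₁)` and `f` kills the second summand
  have hfx : f ((f x).val • x₁) = f x := by
    rw [map_nsmul, hx₁, nsmul_eq_mul, mul_one, ZMod.natCast_zmod_val]
  have hker : x - (f x).val • x₁ = 0 := hf.1 (by rw [map_sub, hfx, sub_self, map_zero])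
  have hx : x = (f x).val • x₁ := sub_eq_zero.mp hker
  have hgx : g x = g ((f x).val • x₁) := congrArg g hx
  rw [hgx, map_nsmul, nsmul_eq_mul, ZMod.natCast_zmod_val, mul_comm]

/-- **Every finite component of every family of local invariant maps is a multiple of THE invariant map**:
`inv_v c = a_v · inv_v^{can} c` for some `a_v ∈ ℤ/n` (`H²(K_v, μₙ) →+ ℤ/n` is free of rank one on the canonical
isomorphism, `canonical_isPerfect`). No hypothesis on `inv`. [cite: CasselsFrohlichANT1967, Ch. VI §1.1]
[cite: MilneADT2006, Ch. I, Cor. 2.3] -/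
theorem exists_eq_mul_localInvariantMap (inv : LocalInvariants K N) (v : HeightOneSpectrum (𝓞 K)) :
    ∃ a : ZMod N, ∀ c, inv (Sum.inr v) c = a * localInvariantMap K N v c :=
  exists_eq_mul_of_bijective (localInvariantMap K N v) (inv (Sum.inr v))
    ((canonical_isPerfect (K := K) (n := N)) v).1

/-- The family of multipliers of §1 as a function of the finite place. [cite: CasselsFrohlichANT1967, Ch. VI §1.1] -/
theorem exists_forall_eq_mul_localInvariantMap (inv : LocalInvariants K N) :
    ∃ a : HeightOneSpectrum (𝓞 K) → ZMod N,
      ∀ (v : HeightOneSpectrum (𝓞 K)) c, inv (Sum.inr v) c = a v * localInvariantMap K N v c := by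
  choose a ha using exists_eq_mul_localInvariantMap inv
  exact ⟨a, ha⟩

omit [NeZero N] in
/-- If `g = a · f` with `g` onto `ℤ/n` (e.g. bijective), the multiplier `a` is a unit. [folklore] -/
private theorem isUnit_of_surjective_of_eq_mul {A : Type*} [AddCommGroup A] (f g : A →+ ZMod N)
    (hg : Surjective g) {a : ZMod N} (ha : ∀ x, g x = a * f x) : IsUnit a := by
  obtain ⟨x, hx⟩ := hg 1
  -- `1 = g x = a * f x`
  exact IsUnit.of_mul_eq_one (f x) (by rw [← ha, hx])

/-- Under `IsPerfect` the multipliers of §1 are UNITS of `ℤ/n`. [cite: MilneADT2006, Ch. I, Cor. 2.3] -/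
theorem isUnit_of_isPerfect_of_eq_mul (inv : LocalInvariants K N) (hperf : inv.IsPerfect)
    (v : HeightOneSpectrum (𝓞 K)) {a : ZMod N} (ha : ∀ c, inv (Sum.inr v) c = a * localInvariantMap K N v c) :
    IsUnit a :=
  isUnit_of_surjective_of_eq_mul (localInvariantMap K N v) (inv (Sum.inr v)) (hperf v).1.2 ha

/-! ### §2 `σ_*` at a fixed place; conjugation compatibility = constancy of the multipliers along `σ` -/

/-- **At a finite place fixed by `σ ∈ Aut(K/ℚ)`, the transport `σ_*` is the identity on `H²(K_v, μₙ)`**: THE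
invariant map is `σ_*`-invariant (`localInvariantMap_muConjPlace`) and injective (`canonical_isPerfect`).
[cite: Neukirch2013, Ch. III §6] [cite: CasselsFrohlichANT1967, Ch. VI §1.1] -/
theorem muConjPlace_two_eq_self {v : HeightOneSpectrum (𝓞 K)} (h : σ • v = v)
    (c : galoisCohomology ((mu K N).toLocal (Sum.inr v : Place K)) 2) :
    muConjPlace σ N h 2 c = c :=
  ((canonical_isPerfect (K := K) (n := N)) v).1.1 (localInvariantMap_muConjPlace σ N h c)

/-- **Conjugation compatibility of a family = constancy of its multipliers along `σ`**: if
`inv_v = a_v · inv_v^{can}` at the finite places, then `inv` is `IsConjCompatible σ` iff `a_w = a_v` whenever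
`σ • v = w`. (⟸: `inv_w (σ_* c) = a_w inv^{can}_w (σ_* c) = a_w inv^{can}_v c`; ⟹: evaluate at a class with
`inv^{can}_v c = 1`.) [cite: Neukirch2013, Ch. III §6] [cite: CasselsFrohlichANT1967, Ch. VI §1.1] -/
theorem isConjCompatible_iff_forall_mul_eq (inv : LocalInvariants K N) (a : HeightOneSpectrum (𝓞 K) → ZMod N)
    (ha : ∀ (v : HeightOneSpectrum (𝓞 K)) c, inv (Sum.inr v) c = a v * localInvariantMap K N v c) :
    inv.IsConjCompatible σ ↔ ∀ (v w : HeightOneSpectrum (𝓞 K)), σ • v = w → a w = a v := by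
  constructor
  · intro hc v w h
    obtain ⟨c, hc1⟩ := ((canonical_isPerfect (K := K) (n := N)) v).1.2 1
    have key := hc v w h c
    rw [ha, ha, localInvariantMap_muConjPlace] at key
    change localInvariantMap K N v c = 1 at hc1
    simpa [hc1] using key
  · intro h v w hvw c
    rw [ha, ha, localInvariantMap_muConjPlace, h v w hvw]

/-- **Every CONSTANT multiple of THE invariant maps at the finite places is conjugation compatible**, for
every `σ ∈ Aut(K/ℚ)` (the infinite components are unconstrained by `IsConjCompatible`).
[cite: Neukirch2013, Ch. III §6] [cite: CasselsFrohlichANT1967, Ch. VI §1.1] -/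
theorem isConjCompatible_of_eq_const_mul (inv : LocalInvariants K N) (a : ZMod N)
    (ha : ∀ (v : HeightOneSpectrum (𝓞 K)) c, inv (Sum.inr v) c = a * localInvariantMap K N v c) :
    inv.IsConjCompatible σ :=
  (isConjCompatible_iff_forall_mul_eq σ inv (fun _ ↦ a) ha).2 fun _ _ _ ↦ rfl

end LocalInvariants

/-! ### §3 The five-conjunct fact = the four-conjunct fact + rigidity -/

/-- **`poitouTate_selmerStructure_duality_conj K` ⟸ `poitouTate_selmerStructure_duality K` + RIGIDITY.**  If
every family of local invariant maps of `K` with local Tate duality (`IsPerfect`) and the Poitou–Tate vanishing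
(`SumLocalTermEqZero`) is a CONSTANT multiple of THE invariant maps at the finite places (`hrig` — true for
number fields by the fundamental exact sequence of class field theory and Grunwald–Wang, NOT proved in the
tree), then the four-conjunct named fact implies the five-conjunct one: the family it provides is conjugation
compatible by `isConjCompatible_of_eq_const_mul`. CONDITIONAL on both displayed hypotheses; this is the exact
content of the gap between the two facts, nothing more. [cite: MilneADT2006, Ch. I, Thm. 4.10(b)]
[cite: CasselsFrohlichANT1967, Ch. VII §10] [cite: Neukirch2013, Ch. III §6] -/
theorem poitouTate_selmerStructure_duality_conj_of_duality_of_rigid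
    (hPT : poitouTate_selmerStructure_duality K)
    (hrig : ∀ (n : ℕ) [NeZero n] (inv : LocalInvariants K n), inv.IsPerfect → inv.SumLocalTermEqZero →
      ∃ a : ZMod n, ∀ (v : HeightOneSpectrum (𝓞 K)) c, inv (Sum.inr v) c = a * localInvariantMap K n v c) :
    poitouTate_selmerStructure_duality_conj K := by
  intro n _
  obtain ⟨inv, h1, h2, h3, h4⟩ := hPT n
  obtain ⟨a, ha⟩ := hrig n inv h1 h2
  exact ⟨inv, h1, h2, h3, h4, fun σ ↦ LocalInvariants.isConjCompatible_of_eq_const_mul σ inv a ha⟩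

end Literature.NumberTheory.GaloisCohomology

end
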